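import Summits.QuantumFields.BalabanUV.Beta.FP.HorizontalTailAssembly

/-!
# `BalabanUV.Beta.FP.TruncatedZerothMoment` — road «FP» for binder row D1, row N7/H3-BOOK (T0-TRUNC): THE (T0)-SMALLNESS OF THE TRUNCATED KERNEL —
# a kernel on `ℤ⁴` with vanishing total sum (the Ward ∕ (T0) letter) and sextic decay has `|Σ_{‖t‖∞≤N} K| ≤ 40·C∕N²`

HONEST DEPENDENCY (page 1, mandatory): continuum YM on T⁴ ⇐ BetaPertH ∧ nine spine estimates (0/9 proved); BetaPertH ⇐ (D1) ∧ (D4) ∧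
CAP+tail; G-an2-4 gates asym, D1 and NE2/3/4.  HONEST FRAMING (cell contract, verbatim): «discharging `BetaPertH` makes Bałaban's UV
stability UNCONDITIONAL — a real constructive-QFT result; it is NOT the continuum limit and NOT the Clay problem.»  THIS MODULE is elementary
[folklore] lattice summation on `ℤ⁴`; it asserts nothing about Bałaban's objects, cites nothing, mints no `Prop` fact, no `def`; 0 `sorry`.  The (T0)
letter `HasSum (K c e) 0` of the FULL kernel is a HYPOTHESIS (on the road: transversality of the unconstrained perfect polarization, row H2-OBJ).
It supplies the input `hA : |Σ' t, truncK K N c e t| ≤ A∕N²` of leaf-02's `HorizontalBookkeeping.pow_six_mul_abs_t0Defect_le` (g5) ∕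
`HorizontalBookkeepingDefectLetters` (g6) with `A := 40·C`.  NOT hbook, NOT hasym, NOT D1, NOT BetaPertH, NOT continuum, NOT Clay.

ABSOLUTE RULE (cell charter, verbatim): «No internally-minted statement may enter as a cited fact. Every hypothesis is either kernel-proved in this
package or a verbatim quotation of a PUBLISHED theorem with page reference. The manuscript(s) under audit are NOT citable for their own disputed
steps — they are the thing under adjudication; programme-internal (2001/route/tribunal) claims are never citable.»

WHAT IS HERE.
* §1 `sum_Ico_inv_cube_le` (`Σ_{N ≤ r < M} (r+1)⁻³ ≤ 1∕(2N²)`, telescoping `(r+1)⁻³ ≤ (2r²)⁻¹ − (2(r+1)²)⁻¹`), `abs_sum_annulus_le_of_sextic`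
  (`|Σ_{N < ‖z‖∞ ≤ M} K z| ≤ 40·C∕N²` for `|K z| ≤ C∕(‖z‖∞+1)⁶`, all `M`, `N ≥ 1`; shells `#{‖z‖∞ = r+1} ≤ 80(r+1)³`, `TransferUV`).
* §2 **`abs_sum_box_le_of_hasSum_zero`** (`HasSum K 0` + sextic decay ⇒ `|Σ_{‖z‖∞ ≤ N} K z| ≤ 40·C∕N²`: the box sum is minus the limit of the shell sums,
  `HorizontalTailAssembly.tendsto_sum_box_of_hasSum`) and **`abs_tsum_truncK_le_of_hasSum_zero`** (the same for `Σ' t, truncK K N c e t`).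
Provenance: D1 formalisation swarm, unit b2b-balaban-beta-d1-formalise-leaf-05 gen 8 (prover-b2b-balaban-beta-d1-formalise-leaf-05-g8-0), 2026-08-20.
-/

noncomputable section

namespace Summit.QuantumFields.BalabanUV.Beta.FP.TruncatedZerothMoment

open Finset Filter Topology
open Literature.Probability.LatticeModels (box mem_box annulus mem_annulus)
open Literature.MathematicalPhysics.QuantumFieldTheory.Balaban1983to89
open Literature.MathematicalPhysics.QuantumFieldTheory.Balaban1983to89.Beta
open Literature.MathematicalPhysics.QuantumFieldTheory.Balaban1983to89.Beta.DyadicShell (Pt supNorm mem_box_iff mem_annulus_iff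
  annulus_eq_union disjoint_annulus supNorm_eq_of_mem_sphere)
open Literature.MathematicalPhysics.QuantumFieldTheory.Balaban1983to89.Beta.TransferUV (card_annulus_succ_four_le abs_sum_annulus_zero_le)
open DressedMomentNormalisation (EKer)
open Summit.QuantumFields.BalabanUV.Beta.FP.HorizontalBookkeeping (truncK truncK_apply truncK_eq_zero_of_not_mem)
open Summit.QuantumFields.BalabanUV.Beta.FP.HorizontalTailAssembly (tendsto_sum_box_of_hasSum)

/-! ## §1 The shell sums beyond radius `N` -/

/-- [folklore] Telescoping: `Σ_{N ≤ r < M} (r+1)⁻³ ≤ 1∕(2N²) − 1∕(2M²)` for `1 ≤ N ≤ M`. -/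
theorem sum_Ico_inv_cube_le' {N M : ℕ} (hN : 1 ≤ N) (hNM : N ≤ M) :
    ∑ r ∈ Finset.Ico N M, 1 / ((r : ℝ) + 1) ^ 3 ≤ 1 / (2 * (N : ℝ) ^ 2) - 1 / (2 * (M : ℝ) ^ 2) := by
  induction M, hNM using Nat.le_induction with
  | base => simp
  | succ M hNM ih =>
    rw [Finset.sum_Ico_succ_top hNM]
    have hM : (1 : ℝ) ≤ M := by exact_mod_cast hN.trans hNM
    have key : 1 / ((M : ℝ) + 1) ^ 3 ≤ 1 / (2 * (M : ℝ) ^ 2) - 1 / (2 * ((M : ℝ) + 1) ^ 2) := by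
      have hM0 : (0 : ℝ) < M := by linarith
      rw [div_sub_div _ _ (by positivity) (by positivity), div_le_div_iff₀ (by positivity) (by positivity)]
      nlinarith [sq_nonneg (M : ℝ), mul_pos hM0 hM0]
    push_cast
    linarith

/-- [folklore] `Σ_{N ≤ r < M} (r+1)⁻³ ≤ 1∕(2N²)` for `1 ≤ N` (any `M`). -/
theorem sum_Ico_inv_cube_le {N : ℕ} (hN : 1 ≤ N) (M : ℕ) :
    ∑ r ∈ Finset.Ico N M, 1 / ((r : ℝ) + 1) ^ 3 ≤ 1 / (2 * (N : ℝ) ^ 2) := by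
  rcases le_or_gt N M with hNM | hMN
  · have h := sum_Ico_inv_cube_le' hN hNM
    have h2 : 0 ≤ 1 / (2 * (M : ℝ) ^ 2) := by positivity
    linarith
  · rw [Finset.Ico_eq_empty (by omega), Finset.sum_empty]; positivity

variable {K : Pt → ℝ} {C : ℝ}

/-- [folklore] **THE SHELL SUMS BEYOND RADIUS `N` ARE `O(N⁻²)`**: `|Σ_{N < ‖z‖∞ ≤ M} K z| ≤ 40·C∕N²` for `|K z| ≤ C∕(‖z‖∞+1)⁶`, `N ≥ 1`, every `M`. -/
theorem abs_sum_annulus_le_of_sextic (hC : 0 ≤ C) (hK : ∀ z : Pt, |K z| ≤ C / ((supNorm z : ℝ) + 1) ^ 6) {N : ℕ} (hN : 1 ≤ N) (M : ℕ) :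
    |∑ z ∈ annulus 4 N M, K z| ≤ 40 * C / (N : ℝ) ^ 2 := by
  classical
  -- read the annulus `(N, M]` as the punctured ball `(0, M]` with the summand cut below radius `N`
  set f : Pt → ℝ := fun z => if N < supNorm z then K z else 0 with hf
  have hfilter : (annulus 4 0 M).filter (fun z => N < supNorm z) = annulus 4 N M := by
    ext z
    rw [Finset.mem_filter, mem_annulus_iff, mem_annulus_iff]
    constructor
    · rintro ⟨⟨-, h2⟩, h3⟩; exact ⟨h3, h2⟩
    · rintro ⟨h1, h2⟩; exact ⟨⟨by omega, h2⟩, h1⟩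
  have hsum : ∑ z ∈ annulus 4 N M, K z = ∑ z ∈ annulus 4 0 M, f z := by
    rw [← hfilter, Finset.sum_filter]
  rw [hsum]
  -- shellwise bound
  set φ : ℕ → ℝ := fun r => if N ≤ r then C / ((r : ℝ) + 1) ^ 6 else 0 with hφ
  have hshell : ∀ r, ∀ z ∈ annulus 4 r (r + 1), |f z| ≤ φ r := by
    intro r z hz
    have hzr : supNorm z = r + 1 := supNorm_eq_of_mem_sphere hz
    simp only [hf, hφ]
    by_cases hNr : N ≤ r
    · rw [if_pos hNr]
      split_ifs
      · have h1 := hK z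
        rw [hzr] at h1; push_cast at h1
        refine h1.trans (div_le_div_of_nonneg_left hC (by positivity) ?_)
        exact pow_le_pow_left₀ (by positivity) (by linarith) 6
      · rw [abs_zero]; positivity
    · rw [if_neg hNr, if_neg (by omega), abs_zero]
  refine (abs_sum_annulus_zero_le hshell).trans ?_
  -- `Σ_{r<M} #shell·φ ≤ 80C·Σ_{N ≤ r < M} (r+1)⁻³ ≤ 40C/N²`
  have hterm : ∀ r ∈ Finset.range M, ((annulus 4 r (r + 1)).card : ℝ) * φ r
      ≤ 80 * C * (if N ≤ r then 1 / ((r : ℝ) + 1) ^ 3 else 0) := by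
    intro r _
    simp only [hφ]
    split_ifs with h
    · have hr : (0 : ℝ) < (r : ℝ) + 1 := by positivity
      calc ((annulus 4 r (r + 1)).card : ℝ) * (C / ((r : ℝ) + 1) ^ 6)
          ≤ 80 * ((r : ℝ) + 1) ^ 3 * (C / ((r : ℝ) + 1) ^ 6) :=
            mul_le_mul_of_nonneg_right (card_annulus_succ_four_le r) (by positivity)
        _ = 80 * C * (1 / ((r : ℝ) + 1) ^ 3) := by field_simp
    · simp
  calc ∑ r ∈ Finset.range M, ((annulus 4 r (r + 1)).card : ℝ) * φ r
      ≤ ∑ r ∈ Finset.range M, 80 * C * (if N ≤ r then 1 / ((r : ℝ) + 1) ^ 3 else 0) := Finset.sum_le_sum hterm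
    _ = 80 * C * ∑ r ∈ Finset.Ico N M, 1 / ((r : ℝ) + 1) ^ 3 := by
        rw [← Finset.mul_sum, ← Finset.sum_filter]
        congr 1
        refine Finset.sum_congr ?_ fun _ _ => rfl
        ext r; simp [Finset.mem_filter, Finset.mem_Ico, and_comm]
    _ ≤ 80 * C * (1 / (2 * (N : ℝ) ^ 2)) := mul_le_mul_of_nonneg_left (sum_Ico_inv_cube_le hN M) (by positivity)
    _ = 40 * C / (N : ℝ) ^ 2 := by field_simp; ring

/-! ## §2 The box sum of a kernel with vanishing total sum -/

/-- [folklore] **(T0) OF THE FULL KERNEL ⇒ (T0)-SMALLNESS OF THE TRUNCATION**: `HasSum K 0` and `|K z| ≤ C∕(‖z‖∞+1)⁶` give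
`|Σ_{‖z‖∞ ≤ N} K z| ≤ 40·C∕N²` for every `N ≥ 1` (the box sum is minus the limit of the shell sums beyond `N`). -/
theorem abs_sum_box_le_of_hasSum_zero (hC : 0 ≤ C) (hK : ∀ z : Pt, |K z| ≤ C / ((supNorm z : ℝ) + 1) ^ 6) (h0 : HasSum K 0)
    {N : ℕ} (hN : 1 ≤ N) : |∑ z ∈ box 4 N, K z| ≤ 40 * C / (N : ℝ) ^ 2 := by
  have hlim := tendsto_sum_box_of_hasSum h0
  -- for `M ≥ N`: `Σ_{box N} = Σ_{box M} − Σ_{annulus N M}`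
  have hsplit : ∀ M, N ≤ M → ∑ z ∈ box 4 N, K z = ∑ z ∈ box 4 M, K z - ∑ z ∈ annulus 4 N M, K z := by
    intro M hNM
    have hsub : box 4 N ⊆ box 4 M := Literature.Probability.LatticeModels.box_mono 4 hNM
    rw [annulus, Finset.sum_sdiff_eq_sub hsub]; ring
  have hbd : ∀ M, N ≤ M → |∑ z ∈ box 4 N, K z| ≤ |∑ z ∈ box 4 M, K z| + 40 * C / (N : ℝ) ^ 2 := by
    intro M hNM
    rw [hsplit M hNM]
    exact (abs_sub _ _).trans (by linarith [abs_sum_annulus_le_of_sextic hC hK hN M])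
  -- pass to the limit `M → ∞`: `|Σ_{box M} K| → 0`
  have hlim' : Tendsto (fun M : ℕ => |∑ z ∈ box 4 M, K z| + 40 * C / (N : ℝ) ^ 2) atTop (𝓝 (|(0 : ℝ)| + 40 * C / (N : ℝ) ^ 2)) :=
    (hlim.abs).add_const _
  rw [abs_zero, zero_add] at hlim'
  exact ge_of_tendsto hlim' (Filter.eventually_atTop.mpr ⟨N, fun M hM => hbd M hM⟩)

/-- [folklore] **THE `hA` INPUT OF THE (T0)-DEFECT BOUND**: for `K : EKer 4` with `HasSum (K c e) 0` and `|K c e t| ≤ C∕(‖t‖∞+1)⁶`,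
`|Σ' t, truncK K N c e t| ≤ 40·C∕N²` (`N ≥ 1`) — the hypothesis `hA` of `HorizontalBookkeeping.pow_six_mul_abs_t0Defect_le` with `A := 40·C`. -/
theorem abs_tsum_truncK_le_of_hasSum_zero {K : EKer 4} {C : ℝ} (hC : 0 ≤ C) (c e : Fin 4)
    (hK : ∀ t : Pt, |K c e t| ≤ C / ((supNorm t : ℝ) + 1) ^ 6) (h0 : HasSum (K c e) 0) {N : ℕ} (hN : 1 ≤ N) :
    |∑' t : Pt, truncK K N c e t| ≤ 40 * C / (N : ℝ) ^ 2 := by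
  have htsum : ∑' t : Pt, truncK K N c e t = ∑ t ∈ box 4 N, K c e t := by
    rw [tsum_eq_sum (s := box 4 N) (fun t ht => truncK_eq_zero_of_not_mem (K := K) (c := c) (e := e) ht)]
    refine Finset.sum_congr rfl fun t ht => ?_
    rw [truncK_apply, if_pos (mem_box_iff.mp ht)]
  rw [htsum]
  exact abs_sum_box_le_of_hasSum_zero hC hK h0 hN

end Summit.QuantumFields.BalabanUV.Beta.FP.TruncatedZerothMoment

end
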